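import Summits.NavierStokesRegularity.NavierStokesRegularity.Theses.PlaneEnergyCeiling

/-!
# Line `mean-dissipation-sieve` for the crux `PlaneEnergyCeiling.PlanarEnergyLiouville`
(item stmt-NavierStokesRegularity-16856; crux-strategist skeleton, 2026-08-17)

LEVER: the time-AVERAGED local energy balance of the ancient solution.  On a fixed ball `B_R(x₀)` the
storage term `½∫|v|²φ_R` is bounded by the Morrey consequence `∫_{B_{2R}}|v|² ≤ 4RM` of the planar
bound UNIFORMLY IN TIME, so after dividing by the window length it disappears, and the cubic /
pressure flux terms obey Tsai's `δ = 1` Saint-Venant bookkeeping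
(`R⁻¹‖v‖²_{L^{12/5}(B_{2R}∖B_R)} ≲ K^{1/3} M^{5/6} R^{-1/6}`, pressure `p = ℛℛ(v⊗v)` split into a local
Calderón–Zygmund part and a harmonic far part of oscillation `≲ M/R²` on `B_{2R}`), exactly as in the
PROVED steady corner (`Tsai2021_annular_liouville_holds`).  Output (stub S1): the space–time dissipation
in `B_R(x₀) × [T, t₁]` is `≤ C₁ R + δ (t₁ - T)` with `δ → 0` as `R → ∞` — the long-time MEAN of the
local dissipation vanishes on every ball, uniformly in the centre.  Stub S2 turns this (Chebyshev in
time + an oscillation lemma `osc_{B_R} f ≲ (‖∇f‖_∞ ∫_{B_{2R}}|∇f|²)^{1/3} + (R⁻¹∫|∇f|²)^{1/2}` + the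
uniform `C²` bounds of bounded ancient mild solutions + `|mean| ≲ √M / R` from the planar bound) into
`L^∞`-QUIET TIMES that are `A(η)·R`-dense: in every window of length `A R` there is a time at which
`|v| ≤ η` on `B_R(x₀)`.  This kills every recurrent ancient dynamics (steady, time-periodic,
quasi-periodic, spatially localised) and leaves the "invader from infinity" as the only enemy; stub S3
(the hard one, OPEN) is the forward-in-time no-invasion Liouville statement.

Composition `PlanarEnergyLiouville_of : S1 → S2 → S3 → PlanarEnergyLiouville` is pure logic.
-/

namespace Summit.NavierStokesRegularity.NavierStokesRegularity.Cruxes.PlanarEnergyLiouville.MeanDissipationSieve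

open scoped BigOperators Topology ENNReal
open Set Function MeasureTheory

open Summit.NavierStokesRegularity.NavierStokesRegularity.Theses.PlaneEnergyCeiling

/-- **S1 — vanishing mean local dissipation (quantitative Theorem A).**  For a bounded ancient mild
solution (`ν = 1`, KNSS duality class), measurable slices, jointly smooth on `(−∞,0) × ℝ³`, with planar
kinetic energies bounded by `M` on every plane and every slice: there is `C₁` such that for every
`δ > 0` there is `R₁ > 0` with
`∫_{T}^{t₁} ∫_{B_R(x₀)} ‖∇v(t,x)‖² dx dt ≤ C₁ R + δ (t₁ − T)` for all `R ≥ R₁`, all centres `x₀` and all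
windows `T < t₁ < 0`.  (Time-averaged local energy equality with a radial cut-off; storage term
`≤ 4RM` by the Morrey consequence of the planar bound; cubic and pressure flux terms by Tsai's `δ = 1`
Saint-Venant bookkeeping in `Ṁ^{2,3} ∩ L^∞`; linear Young iteration over dyadic radii using the a priori
bound `|∇v| ≤ C K²`.)  NEW for this class; size L–XL. -/
theorem stub_meanLocalDissipation :
    ∀ (v : ℝ → EuclideanSpace ℝ (Fin 3) → EuclideanSpace ℝ (Fin 3)),
      Literature.Analysis.FluidPDE.IsBoundedAncientMildSolution 1 v →
      (∀ t < 0, MeasureTheory.AEStronglyMeasurable (v t) MeasureTheory.volume) →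
      ContDiffOn ℝ (⊤ : ℕ∞) (Function.uncurry v) (Set.Iio 0 ×ˢ Set.univ) →
      (∃ M : ℝ, ∀ t < 0, ∀ (R : EuclideanSpace ℝ (Fin 3) ≃ₗᵢ[ℝ] EuclideanSpace ℝ (Fin 3)) (c : ℝ),
        ∫⁻ y : EuclideanSpace ℝ (Fin 2), ‖v t (R (WithLp.toLp 2 ![y 0, y 1, c]))‖ₑ ^ 2 ≤ ENNReal.ofReal M) →
      ∃ C₁ : ℝ, ∀ δ : ℝ, 0 < δ → ∃ R₁ : ℝ, 0 < R₁ ∧ ∀ R : ℝ, R₁ ≤ R →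
        ∀ (x₀ : EuclideanSpace ℝ (Fin 3)) (T t₁ : ℝ), T < t₁ → t₁ < 0 →
          ∫⁻ t in Set.Icc T t₁, ∫⁻ x in Metric.ball x₀ R, ‖fderiv ℝ (v t) x‖ₑ ^ 2
            ≤ ENNReal.ofReal (C₁ * R + δ * (t₁ - T)) := by
  sorry

/-- **S2 — late quiet times are `A·R`-dense.**  Under the crux hypotheses and the mean local
dissipation bound of S1: for every `η > 0` there are `A > 0` and `R₀ > 0` such that for every
`R ≥ R₀`, every centre `x₀` and every `t₁ < 0` some time `τ ∈ [t₁ − A R, t₁]` has `‖v(τ, x)‖ ≤ η` for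
all `x ∈ B_R(x₀)`.  (Chebyshev in time on S1 with `δ = ε/2`, `A = 4C₁/ε + 1` — the radius cancels;
oscillation lemma from `∫_{B_{2R}}|∇v(τ)|² ≤ ε` and the uniform bound on `∇²v` of bounded ancient mild
solutions (KNSS 2009 regularity); the near-constant value has modulus `≲ √M/R` because a constant `b`
on `B_R` has planar energy `π R² |b|²`.)  Size M–L. -/
theorem stub_lateQuietTimes :
    ∀ (v : ℝ → EuclideanSpace ℝ (Fin 3) → EuclideanSpace ℝ (Fin 3)),
      Literature.Analysis.FluidPDE.IsBoundedAncientMildSolution 1 v →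
      (∀ t < 0, MeasureTheory.AEStronglyMeasurable (v t) MeasureTheory.volume) →
      ContDiffOn ℝ (⊤ : ℕ∞) (Function.uncurry v) (Set.Iio 0 ×ˢ Set.univ) →
      (∃ M : ℝ, ∀ t < 0, ∀ (R : EuclideanSpace ℝ (Fin 3) ≃ₗᵢ[ℝ] EuclideanSpace ℝ (Fin 3)) (c : ℝ),
        ∫⁻ y : EuclideanSpace ℝ (Fin 2), ‖v t (R (WithLp.toLp 2 ![y 0, y 1, c]))‖ₑ ^ 2 ≤ ENNReal.ofReal M) →
      (∃ C₁ : ℝ, ∀ δ : ℝ, 0 < δ → ∃ R₁ : ℝ, 0 < R₁ ∧ ∀ R : ℝ, R₁ ≤ R →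
        ∀ (x₀ : EuclideanSpace ℝ (Fin 3)) (T t₁ : ℝ), T < t₁ → t₁ < 0 →
          ∫⁻ t in Set.Icc T t₁, ∫⁻ x in Metric.ball x₀ R, ‖fderiv ℝ (v t) x‖ₑ ^ 2
            ≤ ENNReal.ofReal (C₁ * R + δ * (t₁ - T))) →
      ∀ η : ℝ, 0 < η → ∃ A : ℝ, 0 < A ∧ ∃ R₀ : ℝ, 0 < R₀ ∧ ∀ R : ℝ, R₀ ≤ R →
        ∀ (x₀ : EuclideanSpace ℝ (Fin 3)) (t₁ : ℝ), t₁ < 0 →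
          ∃ τ ∈ Set.Icc (t₁ - A * R) t₁, ∀ x ∈ Metric.ball x₀ R, ‖v τ x‖ ≤ η := by
  sorry

/-- **S3 — Liouville from late quiet times (the forward no-invasion statement; HARDEST, open).**
A bounded ancient mild solution with bounded planar energies whose `L^∞`-quiet times are `A·R`-dense
on every ball (output of S2) and whose mean local dissipation vanishes (output of S1) is identically
zero.  Content: at a point `(t₁, x₀)` with `‖v(t₁,x₀)‖ = a > 0`, the last quiet time `τ ≥ t₁ − A R` of
`B_R(x₀)` starts a FORWARD problem — an `η`-quiet ball of radius `R` is invaded up to amplitude `a` at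
its centre within time `A(η) R`, for every large `R` — to be excluded with the forward tools the
planar class offers (energy of any straight tube of radius `ρ` is `≤ 2ρM`, slab energy law with
bounded Bernoulli flux, Morrey far-field bounds `≲ M/R³` for the Oseen tail, local-energy control on
the time-scale `c(M) R² ≫ A R`).  Every recurrent / spatially localised ancient dynamics is already
excluded by the hypotheses; the residual enemy is a coherent structure travelling in from infinity. -/
theorem stub_liouvilleOfLateQuiet :
    ∀ (v : ℝ → EuclideanSpace ℝ (Fin 3) → EuclideanSpace ℝ (Fin 3)),
      Literature.Analysis.FluidPDE.IsBoundedAncientMildSolution 1 v →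
      (∀ t < 0, MeasureTheory.AEStronglyMeasurable (v t) MeasureTheory.volume) →
      ContDiffOn ℝ (⊤ : ℕ∞) (Function.uncurry v) (Set.Iio 0 ×ˢ Set.univ) →
      (∃ M : ℝ, ∀ t < 0, ∀ (R : EuclideanSpace ℝ (Fin 3) ≃ₗᵢ[ℝ] EuclideanSpace ℝ (Fin 3)) (c : ℝ),
        ∫⁻ y : EuclideanSpace ℝ (Fin 2), ‖v t (R (WithLp.toLp 2 ![y 0, y 1, c]))‖ₑ ^ 2 ≤ ENNReal.ofReal M) →
      (∃ C₁ : ℝ, ∀ δ : ℝ, 0 < δ → ∃ R₁ : ℝ, 0 < R₁ ∧ ∀ R : ℝ, R₁ ≤ R →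
        ∀ (x₀ : EuclideanSpace ℝ (Fin 3)) (T t₁ : ℝ), T < t₁ → t₁ < 0 →
          ∫⁻ t in Set.Icc T t₁, ∫⁻ x in Metric.ball x₀ R, ‖fderiv ℝ (v t) x‖ₑ ^ 2
            ≤ ENNReal.ofReal (C₁ * R + δ * (t₁ - T))) →
      (∀ η : ℝ, 0 < η → ∃ A : ℝ, 0 < A ∧ ∃ R₀ : ℝ, 0 < R₀ ∧ ∀ R : ℝ, R₀ ≤ R →
        ∀ (x₀ : EuclideanSpace ℝ (Fin 3)) (t₁ : ℝ), t₁ < 0 →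
          ∃ τ ∈ Set.Icc (t₁ - A * R) t₁, ∀ x ∈ Metric.ball x₀ R, ‖v τ x‖ ≤ η) →
      ∀ t < 0, ∀ x, v t x = 0 := by
  sorry

/-- **Composition** (pure logic): S1 → S2 → S3 → the crux `PlanarEnergyLiouville`, by name. -/
theorem PlanarEnergyLiouville_of :
    (∀ (v : ℝ → EuclideanSpace ℝ (Fin 3) → EuclideanSpace ℝ (Fin 3)),
      Literature.Analysis.FluidPDE.IsBoundedAncientMildSolution 1 v →
      (∀ t < 0, MeasureTheory.AEStronglyMeasurable (v t) MeasureTheory.volume) →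
      ContDiffOn ℝ (⊤ : ℕ∞) (Function.uncurry v) (Set.Iio 0 ×ˢ Set.univ) →
      (∃ M : ℝ, ∀ t < 0, ∀ (R : EuclideanSpace ℝ (Fin 3) ≃ₗᵢ[ℝ] EuclideanSpace ℝ (Fin 3)) (c : ℝ),
        ∫⁻ y : EuclideanSpace ℝ (Fin 2), ‖v t (R (WithLp.toLp 2 ![y 0, y 1, c]))‖ₑ ^ 2 ≤ ENNReal.ofReal M) →
      ∃ C₁ : ℝ, ∀ δ : ℝ, 0 < δ → ∃ R₁ : ℝ, 0 < R₁ ∧ ∀ R : ℝ, R₁ ≤ R →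
        ∀ (x₀ : EuclideanSpace ℝ (Fin 3)) (T t₁ : ℝ), T < t₁ → t₁ < 0 →
          ∫⁻ t in Set.Icc T t₁, ∫⁻ x in Metric.ball x₀ R, ‖fderiv ℝ (v t) x‖ₑ ^ 2
            ≤ ENNReal.ofReal (C₁ * R + δ * (t₁ - T))) →
    (∀ (v : ℝ → EuclideanSpace ℝ (Fin 3) → EuclideanSpace ℝ (Fin 3)),
      Literature.Analysis.FluidPDE.IsBoundedAncientMildSolution 1 v →
      (∀ t < 0, MeasureTheory.AEStronglyMeasurable (v t) MeasureTheory.volume) →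
      ContDiffOn ℝ (⊤ : ℕ∞) (Function.uncurry v) (Set.Iio 0 ×ˢ Set.univ) →
      (∃ M : ℝ, ∀ t < 0, ∀ (R : EuclideanSpace ℝ (Fin 3) ≃ₗᵢ[ℝ] EuclideanSpace ℝ (Fin 3)) (c : ℝ),
        ∫⁻ y : EuclideanSpace ℝ (Fin 2), ‖v t (R (WithLp.toLp 2 ![y 0, y 1, c]))‖ₑ ^ 2 ≤ ENNReal.ofReal M) →
      (∃ C₁ : ℝ, ∀ δ : ℝ, 0 < δ → ∃ R₁ : ℝ, 0 < R₁ ∧ ∀ R : ℝ, R₁ ≤ R →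
        ∀ (x₀ : EuclideanSpace ℝ (Fin 3)) (T t₁ : ℝ), T < t₁ → t₁ < 0 →
          ∫⁻ t in Set.Icc T t₁, ∫⁻ x in Metric.ball x₀ R, ‖fderiv ℝ (v t) x‖ₑ ^ 2
            ≤ ENNReal.ofReal (C₁ * R + δ * (t₁ - T))) →
      ∀ η : ℝ, 0 < η → ∃ A : ℝ, 0 < A ∧ ∃ R₀ : ℝ, 0 < R₀ ∧ ∀ R : ℝ, R₀ ≤ R →
        ∀ (x₀ : EuclideanSpace ℝ (Fin 3)) (t₁ : ℝ), t₁ < 0 →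
          ∃ τ ∈ Set.Icc (t₁ - A * R) t₁, ∀ x ∈ Metric.ball x₀ R, ‖v τ x‖ ≤ η) →
    (∀ (v : ℝ → EuclideanSpace ℝ (Fin 3) → EuclideanSpace ℝ (Fin 3)),
      Literature.Analysis.FluidPDE.IsBoundedAncientMildSolution 1 v →
      (∀ t < 0, MeasureTheory.AEStronglyMeasurable (v t) MeasureTheory.volume) →
      ContDiffOn ℝ (⊤ : ℕ∞) (Function.uncurry v) (Set.Iio 0 ×ˢ Set.univ) →
      (∃ M : ℝ, ∀ t < 0, ∀ (R : EuclideanSpace ℝ (Fin 3) ≃ₗᵢ[ℝ] EuclideanSpace ℝ (Fin 3)) (c : ℝ),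
        ∫⁻ y : EuclideanSpace ℝ (Fin 2), ‖v t (R (WithLp.toLp 2 ![y 0, y 1, c]))‖ₑ ^ 2 ≤ ENNReal.ofReal M) →
      (∃ C₁ : ℝ, ∀ δ : ℝ, 0 < δ → ∃ R₁ : ℝ, 0 < R₁ ∧ ∀ R : ℝ, R₁ ≤ R →
        ∀ (x₀ : EuclideanSpace ℝ (Fin 3)) (T t₁ : ℝ), T < t₁ → t₁ < 0 →
          ∫⁻ t in Set.Icc T t₁, ∫⁻ x in Metric.ball x₀ R, ‖fderiv ℝ (v t) x‖ₑ ^ 2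
            ≤ ENNReal.ofReal (C₁ * R + δ * (t₁ - T))) →
      (∀ η : ℝ, 0 < η → ∃ A : ℝ, 0 < A ∧ ∃ R₀ : ℝ, 0 < R₀ ∧ ∀ R : ℝ, R₀ ≤ R →
        ∀ (x₀ : EuclideanSpace ℝ (Fin 3)) (t₁ : ℝ), t₁ < 0 →
          ∃ τ ∈ Set.Icc (t₁ - A * R) t₁, ∀ x ∈ Metric.ball x₀ R, ‖v τ x‖ ≤ η) →
      ∀ t < 0, ∀ x, v t x = 0) →
    PlanarEnergyLiouville := by
  intro h1 h2 h3 v hm hmeas hsm hpl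
  have hd := h1 v hm hmeas hsm hpl
  have hq := h2 v hm hmeas hsm hpl hd
  exact h3 v hm hmeas hsm hpl hd hq

/-- The composition applied to the three stubs: the crux, by name (sorries only inside `stub_*`). -/
theorem planarEnergyLiouville_via_sieve : PlanarEnergyLiouville :=
  PlanarEnergyLiouville_of stub_meanLocalDissipation stub_lateQuietTimes stub_liouvilleOfLateQuiet

end Summit.NavierStokesRegularity.NavierStokesRegularity.Cruxes.PlanarEnergyLiouville.MeanDissipationSieve
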